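import Summits.RiemannHypothesis.RiemannHypothesis.Theses.ScrewPolyaSigns
import HarnessLib

/-!
# The thin dipole train (witness against `PolyaLandau`) — part A: the witness, its blocks, measurability

The step dipole train `g` (`±e^{3k}` on `[e^{k∓δ_k}, e^k)` / `[e^k, e^{k+δ_k})`, `δ_k = e^{-2k}/4`, `k ≥ 1`) and the tent
train `h` (`e^{3k}(δ_k - |log x - k|)₊`), the blocks as a countable disjoint family in `(1, ∞)` of lengths `≤ e^{-k}`,
a block-bound integrability criterion, and measurability of `g`, `h`.
Part of the refutation of `ScrewPolyaSigns.PolyaLandau` (stmt-RiemannHypothesis-24181; memo POLYA-DIPOLE-NOTE.md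
a4474ad9b7ab5cd8, rh-idea-3 g4; critic idea-crit-1 / referee ref g11 reads; RULINGs #419/#424, lane K-1, rh-split typer-4 g0).
RH-free real analysis, standard axioms; NEGATIVE KNOWLEDGE; nothing here bears on the truth of RH.
-/

-- D-0017: `Summit.RiemannHypothesis.RiemannHypothesis.…` duplicates the namespace BY DESIGN (single-problem summit).
set_option linter.dupNamespace false

noncomputable section

open Set Filter MeasureTheory Complex
open Literature.NumberTheory.LFunctions

namespace Summit.RiemannHypothesis.RiemannHypothesis.Theorems.ScrewPolyaSignsRefutation

/-! ### The witness -/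

/-- Index of the integer nearest to `log x`. -/
def K (x : ℝ) : ℤ := ⌊Real.log x + 1 / 2⌋

/-- Half-width `δ_t = e^{-2t}/4` of the dipole at `t`. -/
def δ (t : ℝ) : ℝ := Real.exp (-2 * t) / 4

/-- Left end `e^{t - δ_t}` of the block at `t`. -/
def lo (t : ℝ) : ℝ := Real.exp (t - δ t)

/-- Centre `e^t` of the block at `t`. -/
def mid (t : ℝ) : ℝ := Real.exp t

/-- Right end `e^{t + δ_t}` of the block at `t`. -/
def hi (t : ℝ) : ℝ := Real.exp (t + δ t)

/-- The dipole train: `+e^{3k}` on `[lo k, mid k)`, `-e^{3k}` on `[mid k, hi k)` (`k ≥ 1`), `0` elsewhere. -/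
def g (x : ℝ) : ℝ :=
  if 1 ≤ K x ∧ lo (K x) ≤ x ∧ x < mid (K x) then Real.exp (3 * (K x : ℝ))
  else if 1 ≤ K x ∧ mid (K x) ≤ x ∧ x < hi (K x) then -Real.exp (3 * (K x : ℝ)) else 0

/-- The tent train: `e^{3k}(δ_k - |log x - k|)₊` on the `k`-th block (`k ≥ 1`), `0` elsewhere. -/
def h (x : ℝ) : ℝ :=
  if 1 ≤ K x then Real.exp (3 * (K x : ℝ)) * max 0 (δ (K x) - |Real.log x - K x|) else 0

/-! ### Elementary facts about the blocks -/

/-- `δ_t > 0`. -/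
theorem δ_pos (t : ℝ) : 0 < δ t := by unfold δ; positivity

/-- `δ_t ≤ 1/4` for `t ≥ 0`. -/
theorem δ_le {t : ℝ} (ht : 0 ≤ t) : δ t ≤ 1 / 4 := by
  unfold δ
  have : Real.exp (-2 * t) ≤ 1 := Real.exp_le_one_iff.mpr (by linarith)
  linarith

/-- `4 δ_t = e^{-2t}`. -/
theorem four_mul_δ (t : ℝ) : 4 * δ t = Real.exp (-2 * t) := by unfold δ; ring

/-- `lo t > 0`. -/
theorem lo_pos (t : ℝ) : 0 < lo t := Real.exp_pos _

/-- `lo t < mid t`. -/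
theorem lo_lt_mid (t : ℝ) : lo t < mid t := Real.exp_lt_exp.mpr (by linarith [δ_pos t])

/-- `mid t < hi t`. -/
theorem mid_lt_hi (t : ℝ) : mid t < hi t := Real.exp_lt_exp.mpr (by linarith [δ_pos t])

/-- `lo t > 1` for `t ≥ 1`. -/
theorem one_lt_lo {t : ℝ} (ht : 1 ≤ t) : 1 < lo t := by
  have := δ_le (show (0 : ℝ) ≤ t by linarith)
  exact Real.one_lt_exp_iff.mpr (by linarith)

/-- Consecutive blocks are ordered: `hi j ≤ lo k` for integers `0 ≤ j < k`. -/
theorem hi_le_lo {j k : ℤ} (hj : 0 ≤ j) (hjk : j < k) : hi j ≤ lo k := by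
  have h1 : (j : ℝ) + 1 ≤ k := by exact_mod_cast hjk
  have hj' : (0 : ℝ) ≤ j := by exact_mod_cast hj
  have := δ_le hj'
  have := δ_le (show (0 : ℝ) ≤ k by linarith)
  exact Real.exp_le_exp.mpr (by linarith)

/-- `hi t - lo t ≤ e^{-t}` for `t ≥ 0`. -/
theorem hi_sub_lo_le {t : ℝ} (ht : 0 ≤ t) : hi t - lo t ≤ Real.exp (-t) := by
  have hδ := δ_le ht
  have hδ0 := δ_pos t
  have h1 : Real.exp (δ t) - 1 ≤ 2 * δ t := by
    have := Real.abs_exp_sub_one_le (x := δ t) (by rw [abs_of_pos hδ0]; linarith)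
    rw [abs_of_pos hδ0] at this
    exact (le_abs_self _).trans this
  have h2 : 1 - Real.exp (-δ t) ≤ 2 * δ t := by
    have := Real.abs_exp_sub_one_le (x := -δ t) (by rw [abs_neg, abs_of_pos hδ0]; linarith)
    rw [abs_neg, abs_of_pos hδ0] at this
    have := (neg_le_abs (Real.exp (-δ t) - 1)).trans this
    linarith
  have e1 : hi t = Real.exp t * Real.exp (δ t) := by rw [hi, Real.exp_add]
  have e2 : lo t = Real.exp t * Real.exp (-δ t) := by rw [lo, sub_eq_add_neg, Real.exp_add]
  have e3 : Real.exp (-t) = Real.exp t * (4 * δ t) := by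
    rw [four_mul_δ, ← Real.exp_add]; ring_nf
  rw [e1, e2, e3]
  have := Real.exp_pos t
  nlinarith

/-- On the `k`-th block the nearest integer to `log x` is `k`. -/
theorem K_eq {k : ℤ} (hk : 1 ≤ k) {x : ℝ} (h1 : lo k ≤ x) (h2 : x ≤ hi k) : K x = k := by
  have hx : 0 < x := (lo_pos _).trans_le h1
  have hδ := δ_le (show (0 : ℝ) ≤ k by exact_mod_cast (by omega : (0 : ℤ) ≤ k))
  have hδ0 := δ_pos (k : ℝ)
  have hl : (k : ℝ) - δ k ≤ Real.log x := by
    have := Real.log_le_log (lo_pos _) h1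
    rwa [lo, Real.log_exp] at this
  have hu : Real.log x ≤ k + δ k := by
    have := Real.log_le_log hx h2
    rwa [hi, Real.log_exp] at this
  unfold K
  rw [Int.floor_eq_iff]
  constructor <;> linarith

/-- `log` of a point of the `k`-th closed block is within `δ_k` of `k`. -/
theorem abs_log_sub_le {k : ℤ} {x : ℝ} (h1 : lo k ≤ x) (h2 : x ≤ hi k) :
    |Real.log x - k| ≤ δ k := by
  have hx : 0 < x := (lo_pos _).trans_le h1
  rw [abs_le]
  constructor
  · have := Real.log_le_log (lo_pos _) h1
    rw [lo, Real.log_exp] at this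
    linarith
  · have := Real.log_le_log hx h2
    rw [hi, Real.log_exp] at this
    linarith

/-- `g = +e^{3k}` on the left half-block. -/
theorem g_left {k : ℤ} (hk : 1 ≤ k) {x : ℝ} (h1 : lo k ≤ x) (h2 : x < mid k) :
    g x = Real.exp (3 * k) := by
  have hK := K_eq hk h1 (h2.le.trans (mid_lt_hi _).le)
  unfold g
  rw [hK, if_pos ⟨hk, h1, h2⟩]

/-- `g = -e^{3k}` on the right half-block. -/
theorem g_right {k : ℤ} (hk : 1 ≤ k) {x : ℝ} (h1 : mid k ≤ x) (h2 : x < hi k) :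
    g x = -Real.exp (3 * k) := by
  have hK := K_eq hk ((lo_lt_mid _).le.trans h1) h2.le
  unfold g
  rw [hK, if_neg (fun h ↦ absurd h.2.2 (not_lt.mpr h1)), if_pos ⟨hk, h1, h2⟩]

/-- `h = e^{3k}(δ_k - |log x - k|)` on the closed `k`-th block. -/
theorem h_eq {k : ℤ} (hk : 1 ≤ k) {x : ℝ} (h1 : lo k ≤ x) (h2 : x ≤ hi k) :
    h x = Real.exp (3 * k) * (δ k - |Real.log x - k|) := by
  have hK := K_eq hk h1 h2
  have habs := abs_log_sub_le h1 h2
  unfold h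
  rw [hK, if_pos hk, max_eq_right (by linarith)]

/-- Where `g ≠ 0`: inside a block of index `≥ 1`. -/
theorem of_g_ne_zero {x : ℝ} (hx : g x ≠ 0) : 1 ≤ K x ∧ lo (K x) ≤ x ∧ x < hi (K x) := by
  unfold g at hx
  split_ifs at hx with h1 h2
  · exact ⟨h1.1, h1.2.1, h1.2.2.trans (mid_lt_hi _)⟩
  · exact ⟨h2.1, (lo_lt_mid _).le.trans h2.2.1, h2.2.2⟩
  · exact absurd rfl hx

/-- Where `h ≠ 0` (for `x > 0`): strictly inside a block of index `≥ 1`. -/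
theorem of_h_ne_zero {x : ℝ} (hx0 : 0 < x) (hx : h x ≠ 0) :
    1 ≤ K x ∧ lo (K x) < x ∧ x < hi (K x) := by
  unfold h at hx
  split_ifs at hx with h1
  · have hlt : |Real.log x - K x| < δ (K x) := by
      by_contra hle
      have : max 0 (δ (K x) - |Real.log x - K x|) = 0 := max_eq_left (by linarith [not_lt.mp hle])
      rw [this, mul_zero] at hx
      exact hx rfl
    rw [abs_lt] at hlt
    refine ⟨h1, ?_, ?_⟩
    · calc lo (K x) = Real.exp ((K x : ℝ) - δ (K x)) := rfl
        _ < Real.exp (Real.log x) := Real.exp_lt_exp.mpr (by linarith)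
        _ = x := Real.exp_log hx0
    · calc x = Real.exp (Real.log x) := (Real.exp_log hx0).symm
        _ < Real.exp ((K x : ℝ) + δ (K x)) := Real.exp_lt_exp.mpr (by linarith)
        _ = hi (K x) := rfl
  · exact absurd rfl hx

/-! ### Blocks as a countable disjoint family -/

/-- Integer index of the `n`-th block (`n : ℕ`, index `n + 1 ≥ 1`). -/
def kk (n : ℕ) : ℤ := n + 1

/-- `kk n ≥ 1`. -/
theorem one_le_kk (n : ℕ) : 1 ≤ kk n := by unfold kk; omega

/-- The `n`-th block `[lo (n+1), hi (n+1))`. -/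
def B (n : ℕ) : Set ℝ := Ico (lo (kk n)) (hi (kk n))

/-- A point of a block of integer index `k ≥ 1` lies in the union of the blocks. -/
theorem mem_iUnion_B {x : ℝ} {k : ℤ} (hk : 1 ≤ k) (h1 : lo k ≤ x) (h2 : x < hi k) :
    x ∈ ⋃ n, B n := by
  refine mem_iUnion.mpr ⟨(k - 1).toNat, ?_⟩
  have hc : kk (k - 1).toNat = k := by
    unfold kk
    rw [Int.toNat_of_nonneg (by omega)]
    ring
  show x ∈ Ico (lo (kk (k - 1).toNat)) (hi (kk (k - 1).toNat))
  rw [hc]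
  exact ⟨h1, h2⟩

/-- The blocks lie in `(1, ∞)`. -/
theorem B_subset (n : ℕ) : B n ⊆ Ioi 1 := fun x hx ↦
  (one_lt_lo (by unfold kk; exact_mod_cast (by omega : (1 : ℤ) ≤ n + 1))).trans_le hx.1

/-- The union of the blocks lies in `(1, ∞)`. -/
theorem iUnion_B_subset : (⋃ n, B n) ⊆ Ioi 1 := iUnion_subset B_subset

/-- The blocks are pairwise disjoint. -/
theorem B_disjoint : Pairwise (Function.onFun Disjoint B) := by
  have key : ∀ m n : ℕ, m < n → Disjoint (B m) (B n) := by
    intro m n hmn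
    rw [Set.disjoint_left]
    intro x hxm hxn
    have := hi_le_lo (show (0 : ℤ) ≤ kk m by unfold kk; omega) (show kk m < kk n by unfold kk; omega)
    exact absurd (hxm.2.trans_le (this.trans hxn.1)) (lt_irrefl x)
  intro m n hmn
  rcases lt_or_gt_of_ne hmn with hlt | hlt
  · exact key m n hlt
  · exact (key n m hlt).symm

/-- `g` and `h` vanish off the blocks (within `(1, ∞)`). -/
theorem g_h_zero_off {x : ℝ} (hx : x ∈ Ioi (1 : ℝ)) (hxU : x ∉ ⋃ n, B n) : g x = 0 ∧ h x = 0 := by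
  constructor
  · by_contra hg
    obtain ⟨h1, h2, h3⟩ := of_g_ne_zero hg
    exact hxU (mem_iUnion_B h1 h2 h3)
  · by_contra hh
    obtain ⟨h1, h2, h3⟩ := of_h_ne_zero (zero_lt_one.trans hx) hh
    exact hxU (mem_iUnion_B h1 h2.le h3)

/-- Length of the `n`-th block: `≤ e^{-(n+1)}`. -/
theorem volume_real_B_le (n : ℕ) : volume.real (B n) ≤ Real.exp (-(kk n : ℝ)) := by
  rw [B, Real.volume_real_Ico_of_le ((lo_lt_mid _).trans (mid_lt_hi _)).le]
  exact hi_sub_lo_le (by unfold kk; exact_mod_cast (by omega : (0 : ℤ) ≤ n + 1))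

/-- Geometric summability helper: `Σ_n e^{a n + b} < ∞` for `a < 0`. -/
theorem summable_exp_lin {a : ℝ} (b : ℝ) (ha : a < 0) : Summable fun n : ℕ ↦ Real.exp (a * n + b) := by
  have := (Real.summable_exp_nat_mul_iff.mpr ha).mul_right (Real.exp b)
  refine this.congr fun n ↦ ?_
  rw [← Real.exp_add]
  ring_nf

/-- **Integrability from block bounds**: a measurable `f` vanishing off the blocks, with `|f| ≤ M n` on
the `n`-th block and `Σ M n e^{-(n+1)} < ∞`, is integrable on `(1, ∞)`. -/
theorem integrableOn_of_blocks {f : ℝ → ℝ} (hf : Measurable f) (M : ℕ → ℝ)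
    (hM : ∀ n, ∀ x ∈ B n, |f x| ≤ M n)
    (hsum : Summable fun n ↦ M n * Real.exp (-(kk n : ℝ)))
    (hzero : ∀ x ∈ Ioi (1 : ℝ), x ∉ (⋃ n, B n) → f x = 0) : IntegrableOn f (Ioi 1) := by
  have hvol : ∀ n, volume (B n) ≠ ⊤ := fun n ↦ by rw [B, Real.volume_Ico]; exact ENNReal.ofReal_ne_top
  have hB : ∀ n, IntegrableOn f (B n) := fun n ↦
    Measure.integrableOn_of_bounded (hvol n) hf.aestronglyMeasurable
      ((ae_restrict_iff' measurableSet_Ico).mpr (Eventually.of_forall fun x hx ↦ by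
        rw [Real.norm_eq_abs]; exact hM n x hx))
  have hM0 : ∀ n, 0 ≤ M n := fun n ↦
    (abs_nonneg _).trans (hM n (lo (kk n)) ⟨le_rfl, (lo_lt_mid _).trans (mid_lt_hi _)⟩)
  have hU : IntegrableOn f (⋃ n, B n) := by
    refine integrableOn_iUnion_of_summable_integral_norm hB ?_
    refine Summable.of_nonneg_of_le (fun n ↦ integral_nonneg fun x ↦ norm_nonneg _) (fun n ↦ ?_) hsum
    calc ∫ x in B n, ‖f x‖ ≤ ∫ x in B n, M n := by
          refine setIntegral_mono_on (hB n).norm (integrableOn_const (hvol n)) measurableSet_Ico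
            fun x hx ↦ ?_
          rw [Real.norm_eq_abs]
          exact hM n x hx
      _ = M n * volume.real (B n) := by rw [setIntegral_const, smul_eq_mul, mul_comm]
      _ ≤ M n * Real.exp (-(kk n : ℝ)) := mul_le_mul_of_nonneg_left (volume_real_B_le n) (hM0 n)
  exact hU.of_forall_sdiff_eq_zero measurableSet_Ioi fun x hx ↦ hzero x hx.1 hx.2

/-! ### Measurability -/

/-- `K` is measurable. -/
theorem measurable_K : Measurable K := (Real.measurable_log.add_const _).floor

/-- `x ↦ (K x : ℝ)` is measurable. -/
theorem measurable_Kr : Measurable fun x ↦ (K x : ℝ) :=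
  (measurable_from_top (f := fun z : ℤ ↦ (z : ℝ))).comp measurable_K

/-- `g` is measurable. -/
theorem g_measurable : Measurable g := by
  have hK := measurable_Kr
  have h1 : MeasurableSet {x : ℝ | 1 ≤ K x} := measurable_K measurableSet_Ici
  have hδ : Measurable fun x ↦ δ (K x) :=
    ((Real.measurable_exp.comp (hK.const_mul (-2))).div_const 4)
  have hlo : Measurable fun x ↦ lo (K x) := Real.measurable_exp.comp (hK.sub hδ)
  have hmid : Measurable fun x ↦ mid (K x) := Real.measurable_exp.comp hK
  have hhi : Measurable fun x ↦ hi (K x) := Real.measurable_exp.comp (hK.add hδ)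
  have hH : Measurable fun x ↦ Real.exp (3 * (K x : ℝ)) := Real.measurable_exp.comp (hK.const_mul 3)
  refine Measurable.ite (h1.inter ((measurableSet_le hlo measurable_id).inter
    (measurableSet_lt measurable_id hmid))) hH ?_
  exact Measurable.ite (h1.inter ((measurableSet_le hmid measurable_id).inter
    (measurableSet_lt measurable_id hhi))) hH.neg measurable_const

/-- `h` is measurable. -/
theorem h_measurable : Measurable h := by
  have hK := measurable_Kr
  have h1 : MeasurableSet {x : ℝ | 1 ≤ K x} := measurable_K measurableSet_Ici
  have hδ : Measurable fun x ↦ δ (K x) :=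
    ((Real.measurable_exp.comp (hK.const_mul (-2))).div_const 4)
  have hH : Measurable fun x ↦ Real.exp (3 * (K x : ℝ)) := Real.measurable_exp.comp (hK.const_mul 3)
  refine Measurable.ite h1 (hH.mul (measurable_const.max (hδ.sub ?_))) measurable_const
  exact continuous_abs.measurable.comp (Real.measurable_log.sub hK)

end Summit.RiemannHypothesis.RiemannHypothesis.Theorems.ScrewPolyaSignsRefutation
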